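import Literature.MathematicalPhysics.QuantumFieldTheory.Balaban1983to89.B9Eq365TowerXOperatorLadder

/-!
# `Balaban1983to89.B9Eq368TowerFiveFactorWordLadder` — T. Bałaban, *Propagators for lattice gauge theories in a background field*, Commun. Math. Phys. **99** (1985) 389–434
# [Balaban1985BackgroundPropagators] (3.25) p. 394 («R = I − G′Q′*(Q′G′²Q′*)⁻¹Q′G′» in the site form of the NE9 chain's `B9Eq325ProjFormulaTower.RofUk_eq_formula`), (3.68) p. 403 («the
# operators R(U), P(U) = I − R(U) extend analytically to the domain (3.37) and satisfy the same bounds»), Thm 3.1 (3.42) p. 397, Thm 3.2 (3.48) p. 398, with [Balaban1984PropagatorsII]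
# (2.52)–(2.55) p. 232, (2.66) p. 234: **THE TWO-BACKGROUND LADDER FOR A FIVE-FACTOR WORD `G′·Q′*·c·Q′·G′` ON BLOCK MAJORANTS OVER `towerGeom`, ABSTRACTLY** — for fine operators `E, F`
# (`G′(U)`, `G′(1)`), coarse → fine block-diagonal letters `S_U, S_1` (`Q̃′†`), coarse operators `c_U, c_1` (the inverse third operator) and fine → coarse block-diagonal letters `A_U, A_1` (`Q̃′`)
# with decaying ∕ block-diagonal majorants and `O(α)` differences (this lineage's ladders J-10b, J-13∕J-14, J-21), the telescoping
# `E S_U c_U A_U E − F S_1 c_1 A_1 F = (E−F)S_Uc_UA_UE + F(S_U−S_1)c_UA_UE + FS_1(c_U−c_1)A_UE + FS_1c_1(A_U−A_1)E + FS_1c_1A_1(E−F)` and two (2.66)-products per term give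
# **`word(U) − word(1) ≺ K·α·e^{−(δ∕2) d}`** with `K` a polynomial in the input constants — the storey (J′-R) of the lineage memo up to the identification with the chain's `I − R_k(U)`

statement-level skeleton of published theorems with citation tags; proofs where landed; nothing here is a claim about the Yang–Mills mass gap

CITATION HEADER (lean-in-tree rule).  Audit cell `pub-balaban`, sub-cell `t4`, BINDER row NE9; NE9 crux-team LEAF PROVER 01 (`b2b-balaban-t4-ne9-formalise-leaf-01`,
gen 99; bears_on: R4/N22).  Vocabulary BY NAME: pv08's `B6RandomWalk.HasMajorant` ∕ `hasMajorant_mono` ∕ `hasMajorant_add` ∕ `majorant_G0_mul_265` ∕ `c1_nonneg`, `B6RandomWalkHom.HasMajorantHom` ∕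
`hasMajorantHom_iff` ∕ `hasMajorantHom_mono` ∕ `hom_majorant_mul_265`, `B4Sect5Proof.weaken`, this lineage's `B9Eq365TowerXOperatorLadder.hasMajorantHom_comp_ind_left` ∕ `_right`,
`B9Eq341TowerBlockGeometry.towerGeom` ∕ `htri_towerGeom` ∕ `h261_towerGeom` ∕ `hdnn_towerGeom`, `B9Thm34Ext.toB6`.  Sources read through those files' verbatim quotations:
[Balaban1985BackgroundPropagators] pp. 394, 397–398, 403; [Balaban1984PropagatorsII] pp. 232, 234.  [folklore] the telescoping identity; COMPOSITION BY NAME; NOTHING of print's proofs is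
reproduced beyond what the named files prove.

WHAT IS PROVED (sorry-free; proof lane — no `def`).
* **`hasMajorant_word5`** — ONE five-factor word `E″ ∘ S′ ∘ c′ ∘ A′ ∘ E′` with `E″ ≺ g e^{−δd}`, `S′ ≺ 𝟙·s`, `c′ ≺ k e^{−δd}`, `A′ ≺ 𝟙·q`, `E′ ≺ e e^{−δd}` has
  `≺ g·c₁·(s·(k·q·c₁·e))·e^{−(δ∕2)d}` (`c₁ = c₁(d, δ, ½)`).
* **`hasMajorant_word5_sub_word5`** — the two-background difference of the word: `≺ K·α·e^{−(δ∕2)d}` with `K` the displayed polynomial.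
HONEST SCOPE.  Abstract bookkeeping over `towerGeom` (any fine ∕ coarse carriers and block maps); the identification with the chain's `I − R_k(U)` (`RofUk_eq_formula`) and the feeding of
the landed ladders is the NEXT file; constants crude (NOT print's); NE9 NOT PRINTED ∕ NOT PROVED; spine PROVED 0∕9; rung (B)+1 finite T⁴ — NOT infinite volume, NOT mass gap, NOT BetaPertH,
NOT Clay.  HONEST DEPENDENCY: continuum YM on T⁴ ⇐ BetaPertH ∧ nine spine estimates (0/9 proved); BetaPertH ⇐ (D1) ∧ (D4) ∧ CAP+tail; G-an2-4 gates asym, D1 and NE2/3/4.  NEW file;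
nothing modified.  Net new unproved facts: 0.
-/

noncomputable section

open scoped BigOperators

namespace Literature.MathematicalPhysics.QuantumFieldTheory.Balaban1983to89.B9Eq368TowerFiveFactorWordLadder

open B4Sect5Torus (TSite)
open B6RandomWalk (HasMajorant hasMajorant_mono hasMajorant_add majorant_G0_mul_265 c1_nonneg)
open B6RandomWalkHom (HasMajorantHom hasMajorantHom_iff hasMajorantHom_mono hom_majorant_mul_265)
open B4Sect5Proof (weaken)
open B9Thm34Ext (toB6)
open B9Eq341TowerBlockGeometry (towerGeom htri_towerGeom h261_towerGeom hdnn_towerGeom)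
open B9Eq365TowerXOperatorLadder (hasMajorantHom_comp_ind_left hasMajorantHom_comp_ind_right)

variable {d : ℕ} (L : ℕ) (m : Fin d → ℕ) [∀ i, NeZero (m i)] (n : ℕ) (η M Rr : ℝ) (H : Prop)
  {X Y : Type} (blkX : X → TSite d m) (blkY : Y → TSite d m)

/-- **ONE FIVE-FACTOR WORD `E″S′c′A′E′`**: `E″ ≺ g·e^{−δd}` (fine), `S′ ≺ 𝟙·s` (coarse → fine), `c′ ≺ k·e^{−δd}` (coarse), `A′ ≺ 𝟙·q` (fine → coarse), `E′ ≺ e·e^{−δd}` (fine), all constants `≥ 0`,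
`δ > 0` ⟹ `E″ ∘ S′ ∘ c′ ∘ A′ ∘ E′ ≺ g·c₁·(s·(k·q·c₁·e))·e^{−(δ∕2)d}`, `c₁ = c₁(d, δ, ½)` — the block-diagonal letters compose exactly, the two decaying pairs by (2.66).
[cite: Balaban1985BackgroundPropagators, (3.25) p.394, Thm 3.1 (3.42) p.397, Thm 3.2 (3.48) p.398; Balaban1984PropagatorsII, (2.52)–(2.55) p.232, (2.66) p.234] -/
theorem hasMajorant_word5 {E'' E' : Module.End ℝ (X → ℝ)} {S' : (Y → ℝ) →ₗ[ℝ] (X → ℝ)} {c' : Module.End ℝ (Y → ℝ)} {A' : (X → ℝ) →ₗ[ℝ] (Y → ℝ)}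
    {g s k q e δ : ℝ} (hg : 0 ≤ g) (hs : 0 ≤ s) (hk : 0 ≤ k) (hq : 0 ≤ q) (he : 0 ≤ e) (hδ : 0 < δ)
    (hE'' : HasMajorant (g := toB6 (towerGeom L m n η M) Rr H) blkX E'' (fun a b => g * Real.exp (-(δ * (towerGeom L m n η M).dist a b))))
    (hS' : HasMajorantHom (g := toB6 (towerGeom L m n η M) Rr H) blkY blkX S' (fun a b : TSite d m => if a = b then s else 0))
    (hc' : HasMajorant (g := toB6 (towerGeom L m n η M) Rr H) blkY c' (fun a b => k * Real.exp (-(δ * (towerGeom L m n η M).dist a b))))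
    (hA' : HasMajorantHom (g := toB6 (towerGeom L m n η M) Rr H) blkX blkY A' (fun a b : TSite d m => if a = b then q else 0))
    (hE' : HasMajorant (g := toB6 (towerGeom L m n η M) Rr H) blkX E' (fun a b => e * Real.exp (-(δ * (towerGeom L m n η M).dist a b)))) :
    HasMajorant (g := toB6 (towerGeom L m n η M) Rr H) blkX (E'' ∘ₗ (S' ∘ₗ (c' ∘ₗ (A' ∘ₗ E'))))
      (fun a b => g * B6.c1 d δ (1 / 2) * (s * (k * q * B6.c1 d δ (1 / 2) * e)) * Real.exp (-((1 - 1 / 2) * δ * (towerGeom L m n η M).dist a b))) := by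
  have hdnn := hdnn_towerGeom L m n η M
  have htri := htri_towerGeom L m n η M Rr H
  have h261 := h261_towerGeom L m n η M Rr H (by norm_num : (0 : ℝ) < 1 / 2) hδ
  have hc1 : 0 ≤ B6.c1 d δ (1 / 2) := c1_nonneg d _ _
  have hαδ : 0 ≤ (1 - 1 / 2) * δ := by linarith
  have hdist : ∀ a b, (toB6 (towerGeom L m n η M) Rr H).dist a b = (towerGeom L m n η M).dist a b := fun _ _ => rfl
  -- (c′ ∘ A′) ≺ k e^{−δd} · q, then (c′ ∘ A′) ∘ E′ by (2.66)
  have hcA : HasMajorantHom (g := toB6 (towerGeom L m n η M) Rr H) blkX blkY (c' ∘ₗ A')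
      (fun a b => k * q * (fun _ : (toB6 (towerGeom L m n η M) Rr H).Site => (1 : ℝ)) a * Real.exp (-(δ * (towerGeom L m n η M).dist a b))) :=
    hasMajorantHom_mono _ _ (hasMajorantHom_comp_ind_right L m n η M Rr H blkX blkY blkY ((hasMajorantHom_iff _ _ _).2 hc') hA' hq)
      fun a b => le_of_eq (by ring)
  have hE'w : HasMajorant (g := toB6 (towerGeom L m n η M) Rr H) blkX E' (fun a b => e * Real.exp (-((1 - 1 / 2) * δ * (towerGeom L m n η M).dist a b))) :=
    hasMajorant_mono _ hE' fun a b => weaken he le_rfl (by linarith) (hdnn a b)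
  have hcAE := hom_majorant_mul_265 (g := toB6 (towerGeom L m n η M) Rr H) blkX blkY d δ (1 / 2) (k * q) e (fun _ => (1 : ℝ)) (mul_nonneg hk hq)
    (fun _ => zero_le_one) he hαδ htri h261 hcA hE'w
  have hassoc : c' ∘ₗ (A' ∘ₗ E') = (c' ∘ₗ A') ∘ₗ E' := (LinearMap.comp_assoc _ _ _).symm
  rw [hassoc]
  -- S′ ∘ ((c′ ∘ A′) ∘ E′): exact
  have hScAE := hasMajorantHom_comp_ind_left L m n η M Rr H blkX blkY blkX hS' hcAE
    (fun a b => by positivity)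
  -- E″ ∘ (…) by (2.66)
  have hE''1 : HasMajorant (g := toB6 (towerGeom L m n η M) Rr H) blkX E''
      (fun a b => g * (fun _ : (toB6 (towerGeom L m n η M) Rr H).Site => (1 : ℝ)) a * Real.exp (-(δ * (towerGeom L m n η M).dist a b))) :=
    hasMajorant_mono _ hE'' fun a b => le_of_eq (by simp)
  have hinner : HasMajorant (g := toB6 (towerGeom L m n η M) Rr H) blkX (S' ∘ₗ ((c' ∘ₗ A') ∘ₗ E'))
      (fun a b => s * (k * q * B6.c1 d δ (1 / 2) * 1 * e) * Real.exp (-((1 - 1 / 2) * δ * (towerGeom L m n η M).dist a b))) :=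
    (hasMajorantHom_iff _ _ _).1 (hasMajorantHom_mono _ _ hScAE fun a b => le_of_eq (by simp only [hdist]; ring))
  have hP := majorant_G0_mul_265 (g := toB6 (towerGeom L m n η M) Rr H) blkX d δ (1 / 2) g (s * (k * q * B6.c1 d δ (1 / 2) * 1 * e)) (fun _ => (1 : ℝ))
    hg (fun _ => zero_le_one) (by positivity) hαδ htri h261 hE''1 hinner
  rw [Module.End.mul_eq_comp] at hP
  exact hasMajorant_mono _ hP fun a b => le_of_eq (by simp only [hdist]; ring)

/-- **THE TWO-BACKGROUND LADDER OF THE FIVE-FACTOR WORD**: with `F ≺ B_F e^{−δd}`, `E − F ≺ B_D·α·e^{−δd}`; `S_U, S_1 ≺ 𝟙·s_S`, `S_U − S_1 ≺ 𝟙·s_D·α`; `c_U, c_1 ≺ K_c e^{−δd}`,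
`c_U − c_1 ≺ K_D·α·e^{−δd}`; `A_U, A_1 ≺ 𝟙·a_S`, `A_U − A_1 ≺ 𝟙·a_D·α` (all constants `≥ 0`, `0 ≤ α ≤ α₀`, `δ > 0`):
`E S_U c_U A_U E − F S_1 c_1 A_1 F ≺ K·α·e^{−(δ∕2)d}`, `K = c₁²·[B_D s_S K_c a_S B_E + B_F s_D K_c a_S B_E + B_F s_S K_D a_S B_E + B_F s_S K_c a_D B_E + B_F s_S K_c a_S B_D]`, `B_E = B_F + B_Dα₀`.
[cite: Balaban1985BackgroundPropagators, (3.25) p.394, (3.68) p.403, Thm 3.1 (3.42) p.397, Thm 3.2 (3.48) p.398; Balaban1984PropagatorsII, (2.52)–(2.55) p.232, (2.66) p.234] -/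
theorem hasMajorant_word5_sub_word5 {E F : Module.End ℝ (X → ℝ)} {SU S1 : (Y → ℝ) →ₗ[ℝ] (X → ℝ)} {cU c1 : Module.End ℝ (Y → ℝ)} {AU A1 : (X → ℝ) →ₗ[ℝ] (Y → ℝ)}
    {BF BD sS sD Kc KD aS aD α α₀ δ : ℝ} (hBF : 0 ≤ BF) (hBD : 0 ≤ BD) (hsS : 0 ≤ sS) (hsD : 0 ≤ sD) (hKc : 0 ≤ Kc) (hKD : 0 ≤ KD) (haS : 0 ≤ aS) (haD : 0 ≤ aD)
    (hα : 0 ≤ α) (hαα : α ≤ α₀) (hδ : 0 < δ)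
    (hF : HasMajorant (g := toB6 (towerGeom L m n η M) Rr H) blkX F (fun a b => BF * Real.exp (-(δ * (towerGeom L m n η M).dist a b))))
    (hEF : HasMajorant (g := toB6 (towerGeom L m n η M) Rr H) blkX (E - F) (fun a b => BD * α * Real.exp (-(δ * (towerGeom L m n η M).dist a b))))
    (hSU : HasMajorantHom (g := toB6 (towerGeom L m n η M) Rr H) blkY blkX SU (fun a b : TSite d m => if a = b then sS else 0))
    (hS1 : HasMajorantHom (g := toB6 (towerGeom L m n η M) Rr H) blkY blkX S1 (fun a b : TSite d m => if a = b then sS else 0))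
    (hS : HasMajorantHom (g := toB6 (towerGeom L m n η M) Rr H) blkY blkX (SU - S1) (fun a b : TSite d m => if a = b then sD * α else 0))
    (hcU : HasMajorant (g := toB6 (towerGeom L m n η M) Rr H) blkY cU (fun a b => Kc * Real.exp (-(δ * (towerGeom L m n η M).dist a b))))
    (hc1 : HasMajorant (g := toB6 (towerGeom L m n η M) Rr H) blkY c1 (fun a b => Kc * Real.exp (-(δ * (towerGeom L m n η M).dist a b))))
    (hc : HasMajorant (g := toB6 (towerGeom L m n η M) Rr H) blkY (cU - c1) (fun a b => KD * α * Real.exp (-(δ * (towerGeom L m n η M).dist a b))))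
    (hAU : HasMajorantHom (g := toB6 (towerGeom L m n η M) Rr H) blkX blkY AU (fun a b : TSite d m => if a = b then aS else 0))
    (hA1 : HasMajorantHom (g := toB6 (towerGeom L m n η M) Rr H) blkX blkY A1 (fun a b : TSite d m => if a = b then aS else 0))
    (hA : HasMajorantHom (g := toB6 (towerGeom L m n η M) Rr H) blkX blkY (AU - A1) (fun a b : TSite d m => if a = b then aD * α else 0)) :
    HasMajorant (g := toB6 (towerGeom L m n η M) Rr H) blkX
      (E ∘ₗ (SU ∘ₗ (cU ∘ₗ (AU ∘ₗ E))) - F ∘ₗ (S1 ∘ₗ (c1 ∘ₗ (A1 ∘ₗ F))))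
      (fun a b => (B6.c1 d δ (1 / 2) * B6.c1 d δ (1 / 2) *
          (BD * sS * Kc * aS * (BF + BD * α₀) + BF * sD * Kc * aS * (BF + BD * α₀) + BF * sS * KD * aS * (BF + BD * α₀) +
            BF * sS * Kc * aD * (BF + BD * α₀) + BF * sS * Kc * aS * BD)) * α *
        Real.exp (-(δ / 2 * (towerGeom L m n η M).dist a b))) := by
  have hc1h : 0 ≤ B6.c1 d δ (1 / 2) := c1_nonneg d _ _
  have hBE : 0 ≤ BF + BD * α₀ := by nlinarith
  -- `E = F + (E − F) ≺ (B_F + B_Dα₀) e^{−δd}`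
  have hE : HasMajorant (g := toB6 (towerGeom L m n η M) Rr H) blkX E (fun a b => (BF + BD * α₀) * Real.exp (-(δ * (towerGeom L m n η M).dist a b))) := by
    have h := hasMajorant_add _ hF hEF
    rw [add_sub_cancel] at h
    refine hasMajorant_mono _ h fun a b => ?_
    have hex := Real.exp_nonneg (-(δ * (towerGeom L m n η M).dist a b))
    nlinarith [mul_le_mul_of_nonneg_left hαα hBD]
  -- the telescoping
  have hsplit : E ∘ₗ (SU ∘ₗ (cU ∘ₗ (AU ∘ₗ E))) - F ∘ₗ (S1 ∘ₗ (c1 ∘ₗ (A1 ∘ₗ F))) =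
      (E - F) ∘ₗ (SU ∘ₗ (cU ∘ₗ (AU ∘ₗ E))) + (F ∘ₗ ((SU - S1) ∘ₗ (cU ∘ₗ (AU ∘ₗ E))) + (F ∘ₗ (S1 ∘ₗ ((cU - c1) ∘ₗ (AU ∘ₗ E))) +
        (F ∘ₗ (S1 ∘ₗ (c1 ∘ₗ ((AU - A1) ∘ₗ E))) + F ∘ₗ (S1 ∘ₗ (c1 ∘ₗ (A1 ∘ₗ (E - F))))))) := by
    simp only [LinearMap.comp_sub, LinearMap.sub_comp]; abel
  rw [hsplit]
  have hT1 := hasMajorant_word5 L m n η M Rr H blkX blkY (mul_nonneg hBD hα) hsS hKc haS hBE hδ hEF hSU hcU hAU hE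
  have hT2 := hasMajorant_word5 L m n η M Rr H blkX blkY hBF (mul_nonneg hsD hα) hKc haS hBE hδ hF hS hcU hAU hE
  have hT3 := hasMajorant_word5 L m n η M Rr H blkX blkY hBF hsS (mul_nonneg hKD hα) haS hBE hδ hF hS1 hc hAU hE
  have hT4 := hasMajorant_word5 L m n η M Rr H blkX blkY hBF hsS hKc (mul_nonneg haD hα) hBE hδ hF hS1 hc1 hA hE
  have hT5 := hasMajorant_word5 L m n η M Rr H blkX blkY hBF hsS hKc haS (mul_nonneg hBD hα) hδ hF hS1 hc1 hA1 hEF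
  refine hasMajorant_mono _ (hasMajorant_add _ hT1 (hasMajorant_add _ hT2 (hasMajorant_add _ hT3 (hasMajorant_add _ hT4 hT5)))) fun a b => le_of_eq ?_
  show _ = _
  rw [show δ / 2 = (1 - 1 / 2) * δ by ring]
  ring

end Literature.MathematicalPhysics.QuantumFieldTheory.Balaban1983to89.B9Eq368TowerFiveFactorWordLadder

end
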